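import Literature.NumberTheory.CubicFields.ShintaniLandauContour
import HarnessLib

/-!
# Uniform Landau–Shintani estimates, I: `θ^ε(0) ≪ δ̂₁(Φ_m)` and the third difference of the dual series

Topic `Literature/NumberTheory/CubicFields`. The two analytic inputs of Landau's method as run in
Bhargava–Taniguchi–Thorne 2023, §3 (proof of Theorem 3.1, after [LDTT] = Lowry-Duda–Taniguchi–Thorne, *Uniform
bounds for lattice point counting*, §2), for the diagonal Shintani zeta functions `θ^ε = √3 ξ⁺ + ε ξ⁻` of level `m`,
PROVED from the functional-equation schema `HasShintaniFE Φ` (`ShintaniFunctionalEquation.lean`) and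
`btt_uniformity_sqDvd` (Prop. 4.5 at `q = 1`), continuing `ShintaniLandauContour.lean` (`rieszTheta_eq`):

* `exists_norm_thetaCont_zero_le` — **`|θ^ε_cont(0, Φ_m)| ≤ C δ̂₁(Φ_m)` with an ABSOLUTE constant `C`** (BTT p. 11:
  "A straightforward argument shows that `ξ(0, Φ_m) ≪ δ̂₁(Φ_m)` (see [LDTT])"). Proof: in (eq:FE)
  `θ_cont(1−s) = 3ε m^{4s} (Δ(s)/Δ(1−s)) θ(s, Φ̂_m)` let `s → 1⁺` along the reals; `Δ(s)/Δ(1−s) = ((1−s)/2)·Q^ε(s)`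
  with `Q^ε` continuous at `1` (`delta_div_delta_one_sub`, the simple zero of `1/Γ((1−s)/2)`), while
  `|θ(s, Φ̂_m)| ≤ 2 δ̂₁ m⁻⁴ (2 + 1/(s−1))` (`norm_dualTheta_real_le`, partial summation against the majorant); the powers
  of `m` cancel in the limit.
* `exists_norm_fwdDiff_three_dualSeries_le` — for the dual series `W^ε(u) = Σ_n β^ε_n T^ε(n/m⁴, u)` of
  `rieszTheta_eq` and `0 < η ≤ 1/16`: **`‖Δ³_y W^ε(u)‖ ≤ C_η δ̂₁(Φ_m) u^{2+4η} y^{1−4η}`** for `0 < y`, `3y ≤ u`,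
  uniformly in `m` and `Φ` ([LDTT] §2.2–2.3 with `k = 3`, made Bessel-free: the sum over `n` is split at
  `N ≍ m⁴u³/y⁴`; small `n` use the differenced kernel on `Re w = 1/2 − η`
  (`ShintaniLandauKernel.exists_norm_fwdDiff_three_kernelT_le`), large `n` the kernel on `Re w = 5/4 − η` at the four
  nodes (`exists_norm_kernelT_le`); the partial sums of the majorant are `≤ δ̂₁ m⁻⁴ N` and all powers of `m` cancel).
  With `y ≍ u^{2/3}` this is the source of the exponent `2/3 + O(η)` in the sequel (BTT/LDTT reach `3/5` with the
  Bessel expansion of the kernel, which Mathlib lacks; `2/3 + ε` is what (3) of BTT needs).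

Everything here is PROVED; `deltaRatioReg`, `dualSeries` are abbreviations (no named facts).

## References

* M. Bhargava, T. Taniguchi, F. Thorne, *Improved error estimates for the Davenport–Heilbronn theorems*,
  Math. Ann. 389 (2024) = arXiv:2107.12819, §3 (proof of Thm 3.1). [BhargavaTaniguchiThorne2023]
* D. Lowry-Duda, T. Taniguchi, F. Thorne, *Uniform bounds for lattice point counting and partial sums of zeta
  functions*, Math. Z. 300 (2022) = arXiv:1710.02190, §2.2–2.3 ((eq:W_split)–(eq:Wp_final), Lemma 8).
  [LowrydudaTaniguchiThorne2017]
-/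

noncomputable section

open Complex Real Set Filter MeasureTheory Topology
open Literature.NumberTheory.CubicFields.ShintaniGamma Literature.NumberTheory.CubicFields.LandauContour

namespace Literature.NumberTheory.CubicFields

namespace LandauShintani

variable {m : ℕ}

/-! ### `θ^ε_cont(0, Φ_m) ≪ δ̂₁(Φ_m)` with an absolute constant -/

/-- The regular part of `Δ^ε(s)/Δ^ε(1−s)` at `s = 1`:
`Q^ε(s) := Δ^ε(s) (2⁴3⁶/π⁴)^{−(1−s)/2} / (Γ((1−s)/2 + 1) Γ((1−s)/2 + 1/2) Γ((1−s)/2 + β₃) Γ((1−s)/2 + β₄))`.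
[cite: BhargavaTaniguchiThorne2023, §2.4 (Δ^±) with §3 ("ξ(0, Φ_m) ≪ δ̂₁(Φ_m)")] -/
def deltaRatioReg (ε : ℤ) (s : ℂ) : ℂ :=
  delta ε s * ((deltaConst : ℂ) ^ (-((1 - s) / 2)) * ((Gamma ((1 - s) / 2 + 1))⁻¹ * (Gamma ((1 - s) / 2 + 1 / 2))⁻¹ *
    (Gamma ((1 - s) / 2 + shift₃ ε))⁻¹ * (Gamma ((1 - s) / 2 + shift₄ ε))⁻¹))

/-- **`Δ^ε(s)/Δ^ε(1−s) = ((1−s)/2) · Q^ε(s)`** (the simple zero of `1/Γ((1−s)/2)` at `s = 1`: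
`1/Γ(w) = w/Γ(w+1)`). [folklore] -/
theorem delta_div_delta_one_sub (ε : ℤ) (s : ℂ) :
    delta ε s / delta ε (1 - s) = (1 - s) / 2 * deltaRatioReg ε s := by
  have h : delta ε (1 - s) = (deltaConst : ℂ) ^ ((1 - s) / 2) * (Gamma ((1 - s) / 2) * Gamma ((1 - s) / 2 + 1 / 2) *
      Gamma ((1 - s) / 2 + shift₃ ε) * Gamma ((1 - s) / 2 + shift₄ ε)) := rfl
  rw [div_eq_mul_inv, h, mul_inv, mul_inv, mul_inv, mul_inv, ← cpow_neg,
    one_div_Gamma_eq_self_mul_one_div_Gamma_add_one ((1 - s) / 2), deltaRatioReg]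
  ring

/-- `Q^ε` is continuous at `s = 1` (indeed holomorphic on `Re s > 1/6`). [folklore] -/
theorem continuousAt_deltaRatioReg (ε : ℤ) : ContinuousAt (deltaRatioReg ε) 1 := by
  have hΔ : DifferentiableAt ℂ (delta ε) 1 :=
    (differentiableOn_delta ε).differentiableAt ((isOpen_lt continuous_const continuous_re).mem_nhds (by simp; norm_num))
  have hc : DifferentiableAt ℂ (fun s : ℂ => (deltaConst : ℂ) ^ (-((1 - s) / 2))) 1 :=
    DifferentiableAt.const_cpow (by fun_prop) (Or.inl (by exact_mod_cast deltaConst_pos.ne'))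
  have hG : ∀ c : ℂ, DifferentiableAt ℂ (fun s : ℂ => (Gamma ((1 - s) / 2 + c))⁻¹) 1 := fun c => by
    have h := differentiable_one_div_Gamma.differentiableAt (x := (1 - (1 : ℂ)) / 2 + c)
    have h2 : DifferentiableAt ℂ (fun s : ℂ => (1 - s) / 2 + c) 1 := by fun_prop
    exact DifferentiableAt.comp (1 : ℂ) (g := fun s : ℂ => (Gamma s)⁻¹) (f := fun s : ℂ => (1 - s) / 2 + c) h h2
  unfold deltaRatioReg
  exact (hΔ.mul (hc.mul ((((hG 1).mul (hG (1 / 2))).mul (hG _)).mul (hG _)))).continuousAt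

/-- **`‖θ^ε(s, Φ̂_m)‖ ≤ 2 δ̂₁(Φ_m) m⁻⁴ (2 + 1/(s−1))` for real `s > 1`** (the dual series against its majorant,
by partial summation `LandauSums.tsum_shift_mul_rpow_neg_le`). [folklore] -/
theorem norm_dualTheta_real_le [NeZero m] (hU : btt_uniformity_sqDvd) {ε : ℤ} (hε : ε = 1 ∨ ε = -1)
    (Φ : BinaryCubic (ZMod m) → ℂ) {s : ℝ} (hs : 1 < s) :
    ‖dualTheta ε Φ s‖ ≤ 2 * (dualDensity Φ / (m : ℝ) ^ 4) * (2 + 1 / (s - 1)) := by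
  have hA := sum_range_dualMajorant_le hU Φ
  have hx := dualMajorant_nonneg Φ
  have hsum := LandauSums.summable_mul_rpow_neg hx hA hs
  have htail := LandauSums.tsum_shift_mul_rpow_neg_le hx hA hs (N := 1) le_rfl
  have hs' : 1 < ((s : ℂ)).re := by simpa using hs
  rw [dualTheta_eq_LSeries hU ε Φ hs']
  have h1 := norm_LSeries_le_of_le_re (lseriesSummable_dualThetaCoeff hU ε Φ hs') (s := (s : ℂ)) (by simp)
  refine h1.trans ?_
  have hle : ∀ n, ‖LSeries.term (dualThetaCoeff ε Φ) (s : ℂ) n‖ ≤ 2 * (dualMajorant Φ n * (n : ℝ) ^ (-s)) := by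
    intro n
    rcases Nat.eq_zero_or_pos n with rfl | hn
    · simp [dualMajorant]
    · rw [LSeries.term_of_ne_zero hn.ne', norm_div, norm_natCast_cpow_of_pos hn, ofReal_re, div_eq_mul_inv,
        ← Real.rpow_neg (Nat.cast_nonneg n)]
      calc ‖dualThetaCoeff ε Φ n‖ * (n : ℝ) ^ (-s) ≤ 2 * dualMajorant Φ n * (n : ℝ) ^ (-s) := by
            gcongr; exact norm_dualThetaCoeff_le Φ hε hn.ne'
        _ = 2 * (dualMajorant Φ n * (n : ℝ) ^ (-s)) := by ring
  have hsum2 : Summable fun n => 2 * (dualMajorant Φ n * (n : ℝ) ^ (-s)) := hsum.mul_left 2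
  have hsumm1 : Summable fun n => ‖LSeries.term (dualThetaCoeff ε Φ) (s : ℂ) n‖ :=
    .of_nonneg_of_le (fun _ => norm_nonneg _) hle hsum2
  have h0 : dualMajorant Φ 0 * ((0 : ℕ) : ℝ) ^ (-s) = 0 := by simp [dualMajorant]
  calc ∑' n, ‖LSeries.term (dualThetaCoeff ε Φ) (s : ℂ) n‖ ≤ ∑' n, 2 * (dualMajorant Φ n * (n : ℝ) ^ (-s)) :=
        Summable.tsum_le_tsum hle hsumm1 hsum2
    _ = 2 * ∑' n, dualMajorant Φ n * (n : ℝ) ^ (-s) := tsum_mul_left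
    _ = 2 * ∑' k, dualMajorant Φ (1 + k) * ((1 + k : ℕ) : ℝ) ^ (-s) := by
        congr 1
        rw [hsum.tsum_eq_zero_add, h0, zero_add]
        exact tsum_congr fun k => by rw [add_comm]
    _ ≤ 2 * (dualDensity Φ / (m : ℝ) ^ 4 * (2 + 1 / (s - 1)) * ((1 : ℕ) : ℝ) ^ (1 - s)) := by gcongr
    _ = 2 * (dualDensity Φ / (m : ℝ) ^ 4) * (2 + 1 / (s - 1)) := by simp; ring

/-- **`θ^ε_cont(0, Φ_m) ≪ δ̂₁(Φ_m)` with an ABSOLUTE implied constant** (BTT §3: "A straightforward argument shows that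
`ξ(0, Φ_m) ≪ δ̂₁(Φ_m)` (see [LDTT])"): let `s → 1⁺` in (eq:FE) `θ_cont(1−s) = 3ε m^{4s} (Δ(s)/Δ(1−s)) θ(s, Φ̂_m)`;
`Δ(s)/Δ(1−s) = ((1−s)/2)Q(s)` vanishes to first order while `|θ(s, Φ̂_m)| ≤ 2δ̂₁m⁻⁴(2 + 1/(s−1))`, and `m^{4s}m⁻⁴ → 1`.
[cite: BhargavaTaniguchiThorne2023, §3 proof of Thm 3.1 ("ξ(0, Φ_m) ≪ δ̂₁(Φ_m)")] -/
theorem exists_norm_thetaCont_zero_le (hU : btt_uniformity_sqDvd) :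
    ∃ C : ℝ, 0 < C ∧ ∀ (m : ℕ) [NeZero m] (Φ : BinaryCubic (ZMod m) → ℂ), HasShintaniFE Φ →
      ∀ ε : ℤ, (ε = 1 ∨ ε = -1) → ‖thetaCont ε Φ 0‖ ≤ C * dualDensity Φ := by
  refine ⟨3 * max ‖deltaRatioReg 1 1‖ ‖deltaRatioReg (-1) 1‖ + 1, by positivity, fun m _ Φ hFE ε hε => ?_⟩
  have hD := dualDensity_nonneg Φ
  have hm : (0 : ℝ) < m := by exact_mod_cast NeZero.pos m
  have hεn : ‖(ε : ℂ)‖ = 1 := by rcases hε with rfl | rfl <;> simp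
  -- the bound for real `s ∈ (1, 13/12)`
  have key : ∀ s : ℝ, 1 < s → s < 13 / 12 → ‖thetaCont ε Φ (1 - (s : ℂ))‖ ≤
      3 * (m : ℝ) ^ (4 * (s - 1)) * ‖deltaRatioReg ε s‖ * dualDensity Φ * (2 * (s - 1) + 1) := by
    intro s hs1 hs2
    have hdual := norm_dualTheta_real_le hU hε Φ hs1
    rw [hFE.fe ε hε s (by simpa using hs1) (by simp only [ofReal_re]; linarith), delta_div_delta_one_sub]
    have hm4 : ‖(m : ℂ) ^ (4 * (s : ℂ))‖ = (m : ℝ) ^ (4 * s) := by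
      rw [norm_natCast_cpow_of_pos (NeZero.pos m)]; congr 1; simp
    have h1s : ‖(1 - (s : ℂ)) / 2‖ = (s - 1) / 2 := by
      rw [show (1 - (s : ℂ)) / 2 = (((1 - s) / 2 : ℝ) : ℂ) by push_cast; ring, Complex.norm_real, Real.norm_eq_abs,
        abs_of_nonpos (by linarith)]
      ring
    have hpow : (m : ℝ) ^ (4 * s) / (m : ℝ) ^ 4 = (m : ℝ) ^ (4 * (s - 1)) := by
      rw [show (4 * (s - 1) : ℝ) = 4 * s - 4 by ring, Real.rpow_sub hm, show ((m : ℝ) ^ 4 : ℝ) = (m : ℝ) ^ (4 : ℝ) by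
        rw [show (4 : ℝ) = (4 : ℕ) by norm_num, Real.rpow_natCast]]
    have hs0 : 0 < s - 1 := by linarith
    calc ‖3 * (ε : ℂ) * (m : ℂ) ^ (4 * (s : ℂ)) * ((1 - (s : ℂ)) / 2 * deltaRatioReg ε s) * dualTheta ε Φ s‖
        = 3 * (m : ℝ) ^ (4 * s) * ((s - 1) / 2 * ‖deltaRatioReg ε s‖) * ‖dualTheta ε Φ s‖ := by
          simp only [norm_mul, hεn, hm4, h1s, mul_one]; norm_num
      _ ≤ 3 * (m : ℝ) ^ (4 * s) * ((s - 1) / 2 * ‖deltaRatioReg ε s‖) *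
            (2 * (dualDensity Φ / (m : ℝ) ^ 4) * (2 + 1 / (s - 1))) := by gcongr
      _ = 3 * ((m : ℝ) ^ (4 * s) / (m : ℝ) ^ 4) * ‖deltaRatioReg ε s‖ * dualDensity Φ * ((s - 1) * (2 + 1 / (s - 1))) := by
          ring
      _ = 3 * (m : ℝ) ^ (4 * (s - 1)) * ‖deltaRatioReg ε s‖ * dualDensity Φ * (2 * (s - 1) + 1) := by
          rw [hpow]; congr 1; field_simp
  -- the limit `s → 1⁺`
  have hlim1 : Tendsto (fun s : ℝ => ‖thetaCont ε Φ (1 - (s : ℂ))‖) (𝓝[>] 1) (𝓝 ‖thetaCont ε Φ 0‖) := by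
    have hθ : ContinuousAt (thetaCont ε Φ) 0 :=
      ((differentiableOn_thetaCont ε Φ).differentiableAt
        ((isOpen_ne.inter isOpen_ne).mem_nhds ⟨zero_ne_one, by norm_num⟩)).continuousAt
    have hc : Continuous fun s : ℝ => 1 - (s : ℂ) := by fun_prop
    have h1 : (fun s : ℝ => 1 - (s : ℂ)) 1 = 0 := by simp
    have h := ((hθ.comp_of_eq hc.continuousAt h1).norm).tendsto
    simp only [Function.comp_def, ofReal_one, sub_self] at h
    exact tendsto_nhdsWithin_of_tendsto_nhds h
  have hlim2 : Tendsto (fun s : ℝ => 3 * (m : ℝ) ^ (4 * (s - 1)) * ‖deltaRatioReg ε s‖ * dualDensity Φ * (2 * (s - 1) + 1))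
      (𝓝[>] 1) (𝓝 (3 * 1 * ‖deltaRatioReg ε 1‖ * dualDensity Φ * 1)) := by
    refine tendsto_nhdsWithin_of_tendsto_nhds ?_
    have h4 : Tendsto (fun s : ℝ => 4 * (s - 1)) (𝓝 1) (𝓝 0) := by
      have := (by fun_prop : Continuous fun s : ℝ => 4 * (s - 1)).tendsto 1; simpa using this
    have hpow : Tendsto (fun s : ℝ => (m : ℝ) ^ (4 * (s - 1))) (𝓝 1) (𝓝 1) := by
      have := (Real.continuousAt_const_rpow (b := 0) hm.ne').tendsto.comp h4
      simpa [Function.comp_def] using this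
    have hof : Tendsto (fun s : ℝ => (s : ℂ)) (𝓝 1) (𝓝 1) := by
      have := continuous_ofReal.tendsto (1 : ℝ); simpa using this
    have hQ : Tendsto (fun s : ℝ => ‖deltaRatioReg ε s‖) (𝓝 1) (𝓝 ‖deltaRatioReg ε 1‖) := by
      have := ((continuousAt_deltaRatioReg ε).tendsto.comp hof).norm
      simpa [Function.comp_def] using this
    have hlin : Tendsto (fun s : ℝ => 2 * (s - 1) + 1) (𝓝 1) (𝓝 1) := by
      have := (by fun_prop : Continuous fun s : ℝ => 2 * (s - 1) + 1).tendsto 1; norm_num at this; exact this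
    exact (((hpow.const_mul 3).mul hQ).mul_const (dualDensity Φ)).mul hlin
  have hev : ∀ᶠ s : ℝ in 𝓝[>] (1 : ℝ), ‖thetaCont ε Φ (1 - (s : ℂ))‖ ≤
      3 * (m : ℝ) ^ (4 * (s - 1)) * ‖deltaRatioReg ε s‖ * dualDensity Φ * (2 * (s - 1) + 1) := by
    filter_upwards [Ioo_mem_nhdsGT (show (1 : ℝ) < 13 / 12 by norm_num)] with s hs
    exact key s hs.1 hs.2
  have hle := le_of_tendsto_of_tendsto hlim1 hlim2 hev
  calc ‖thetaCont ε Φ 0‖ ≤ 3 * 1 * ‖deltaRatioReg ε 1‖ * dualDensity Φ * 1 := hle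
    _ = 3 * ‖deltaRatioReg ε 1‖ * dualDensity Φ := by ring
    _ ≤ (3 * max ‖deltaRatioReg 1 1‖ ‖deltaRatioReg (-1) 1‖ + 1) * dualDensity Φ := by
        have hmax : ‖deltaRatioReg ε 1‖ ≤ max ‖deltaRatioReg 1 1‖ ‖deltaRatioReg (-1) 1‖ := by
          rcases hε with rfl | rfl
          · exact le_max_left _ _
          · exact le_max_right _ _
        nlinarith


/-! ### The dual series `W^ε(u) = Σ_n β^ε_n T^ε(n/m⁴, u)` and its third difference -/

/-- **`W^ε(u, Φ_m) := Σ_n β^ε_n T^ε_{13/12}(n/m⁴, u)`**, the dual side of Landau's identity `rieszTheta_eq` (without the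
factor `3ε`). [cite: BhargavaTaniguchiThorne2023, §3 proof of Thm 3.1 (the term m^{4k+4} Σ a(Φ̂_m, n) n^{-k-1} I_k(nX/m⁴), k = 3)] -/
def dualSeries (ε : ℤ) (Φ : BinaryCubic (ZMod m) → ℂ) (u : ℝ) : ℂ :=
  ∑' n : ℕ, dualThetaCoeff ε Φ n * kernelT ε (13 / 12) ((n : ℝ) / (m : ℝ) ^ 4) u

/-- `T^ε_σ(0, X) = 0` (`σ ≠ 0`). [folklore] -/
theorem kernelT_zero_nu (ε : ℤ) {σ : ℝ} (hσ : σ ≠ 0) (X : ℝ) : kernelT ε σ 0 X = 0 := by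
  unfold kernelT
  have h : ∀ u : ℝ, kernelIntegrand ε 0 X ((σ : ℂ) + u * I) = 0 := fun u => by
    unfold kernelIntegrand
    rw [ofReal_zero, zero_cpow (fun h => ?_), zero_mul, mul_zero]
    have := congrArg re h; simp at this; exact hσ this
  simp [h]

/-- `‖Δ³_y f(X)‖ ≤ 8B` when `‖f‖ ≤ B` at the four nodes. [folklore] -/
theorem norm_fwdDiff_three_le_of_le {f : ℝ → ℂ} {y X B : ℝ} (h0 : ‖f X‖ ≤ B) (h1 : ‖f (X + y)‖ ≤ B)
    (h2 : ‖f (X + 2 * y)‖ ≤ B) (h3 : ‖f (X + 3 * y)‖ ≤ B) : ‖((fwdDiff y)^[3] f) X‖ ≤ 8 * B := by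
  rw [LandauDiff.fwdDiff_iter_three_apply]
  have e3 : ‖(3 : ℂ)‖ = 3 := by simp
  calc ‖f (X + 3 * y) - 3 * f (X + 2 * y) + 3 * f (X + y) - f X‖
      ≤ ‖f (X + 3 * y)‖ + ‖(3 : ℂ) * f (X + 2 * y)‖ + ‖(3 : ℂ) * f (X + y)‖ + ‖f X‖ := by
        refine (norm_sub_le _ _).trans ?_
        gcongr
        exact (norm_add_le _ _).trans (by gcongr; exact norm_sub_le _ _)
    _ ≤ B + 3 * B + 3 * B + B := by rw [norm_mul, norm_mul, e3]; gcongr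
    _ = 8 * B := by ring

/-- The terms of `W^ε(u)` are absolutely summable for `u > 0` (`|β_n T(n/m⁴, u)| ≪ |β_n| (n/m⁴)^{−13/12} u^{35/12}`).
[folklore] -/
theorem summable_dualSeries_term [NeZero m] (hU : btt_uniformity_sqDvd) {ε : ℤ} (hε : ε = 1 ∨ ε = -1)
    (Φ : BinaryCubic (ZMod m) → ℂ) {u : ℝ} (hu : 0 < u) :
    Summable fun n : ℕ => dualThetaCoeff ε Φ n * kernelT ε (13 / 12) ((n : ℝ) / (m : ℝ) ^ 4) u := by
  obtain ⟨C, hC, hT⟩ := exists_norm_kernelT_le (σ₁ := 13 / 12) (σ₂ := 13 / 12) (by norm_num) (by norm_num)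
  have hm4 : (0 : ℝ) < (m : ℝ) ^ 4 := by have := NeZero.pos m; positivity
  have hS := (summable_norm_dualThetaCoeff_mul hU hε Φ (σ := 13 / 12) (by norm_num)).mul_left
    (C * ((m : ℝ) ^ 4) ^ (13 / 12 : ℝ) * u ^ (4 - 13 / 12 : ℝ))
  refine Summable.of_norm_bounded hS (fun n => ?_)
  rcases Nat.eq_zero_or_pos n with rfl | hn
  · simp [kernelT_zero_nu ε (by norm_num : (13 / 12 : ℝ) ≠ 0)]
  · have hν : (0 : ℝ) < n / (m : ℝ) ^ 4 := by positivity
    rw [norm_mul]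
    calc ‖dualThetaCoeff ε Φ n‖ * ‖kernelT ε (13 / 12) ((n : ℝ) / (m : ℝ) ^ 4) u‖
        ≤ ‖dualThetaCoeff ε Φ n‖ * (C * (((n : ℝ) / (m : ℝ) ^ 4) ^ (-(13 / 12 : ℝ)) * u ^ (4 - 13 / 12 : ℝ))) := by
          gcongr; exact hT ε hε _ ⟨le_rfl, le_rfl⟩ _ _ hν hu
      _ = C * ((m : ℝ) ^ 4) ^ (13 / 12 : ℝ) * u ^ (4 - 13 / 12 : ℝ) * (‖dualThetaCoeff ε Φ n‖ * (n : ℝ) ^ (-(13 / 12 : ℝ))) := by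
          rw [Real.div_rpow (by positivity) hm4.le, Real.rpow_neg hm4.le, div_inv_eq_mul]; ring

/-- **`Δ³_y W^ε(u) = Σ_n β^ε_n Δ³_y T^ε(n/m⁴, ·)(u)`** (`u > 0`, `y ≥ 0`; absolute convergence at the four nodes). [folklore] -/
theorem fwdDiff_three_dualSeries [NeZero m] (hU : btt_uniformity_sqDvd) {ε : ℤ} (hε : ε = 1 ∨ ε = -1)
    (Φ : BinaryCubic (ZMod m) → ℂ) {u y : ℝ} (hu : 0 < u) (hy : 0 ≤ y) :
    ((fwdDiff y)^[3] (dualSeries ε Φ)) u =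
      ∑' n : ℕ, dualThetaCoeff ε Φ n * ((fwdDiff y)^[3] (fun X' => kernelT ε (13 / 12) ((n : ℝ) / (m : ℝ) ^ 4) X')) u := by
  have h0 := summable_dualSeries_term hU hε Φ hu
  have h1 := summable_dualSeries_term hU hε Φ (u := u + y) (by linarith)
  have h2 := summable_dualSeries_term hU hε Φ (u := u + 2 * y) (by linarith)
  have h3 := summable_dualSeries_term hU hε Φ (u := u + 3 * y) (by linarith)
  rw [LandauDiff.fwdDiff_iter_three_apply]
  simp only [dualSeries]
  rw [← tsum_mul_left (a := (3 : ℂ)), ← tsum_mul_left (a := (3 : ℂ)), ← (h3.tsum_sub (h2.mul_left 3)),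
    ← Summable.tsum_add (h3.sub (h2.mul_left 3)) (h1.mul_left 3), ← Summable.tsum_sub ((h3.sub (h2.mul_left 3)).add (h1.mul_left 3)) h0]
  exact tsum_congr fun n => by rw [LandauDiff.fwdDiff_iter_three_apply]; ring

/-- `(u³/y⁴)^c = u^{3c} y^{−4c}`. [folklore] -/
theorem rpow_cube_div_fourth {u y : ℝ} (hu : 0 < u) (hy : 0 < y) (c : ℝ) :
    (u ^ 3 / y ^ 4) ^ c = u ^ (3 * c) * y ^ (-(4 * c)) := by
  rw [Real.div_rpow (by positivity) (by positivity), show (u ^ 3 : ℝ) = u ^ (3 : ℝ) by norm_cast,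
    show (y ^ 4 : ℝ) = y ^ (4 : ℝ) by norm_cast, ← Real.rpow_mul hu.le, ← Real.rpow_mul hy.le, Real.rpow_neg hy.le,
    div_eq_mul_inv]

/-- **The third difference of the dual series, uniformly in `m`** ([LDTT] §2.2–2.3 made explicit, order `k = 3`,
Bessel-free): for `0 < η ≤ 1/16` there is `C_η` such that for every level `m`, every `Φ`, `ε = ±1`, and
`0 < y`, `3y ≤ u`:  `‖Δ³_y W^ε(u, Φ_m)‖ ≤ C_η δ̂₁(Φ_m) u^{2+4η} y^{1−4η}`.
Proof: split `Σ_n` at `N ≍ m⁴u³/y⁴`; for `n < N` use `‖Δ³_y T(ν,·)(u)‖ ≪ y³ ν^{−σ₀}(u+3y)^{1−σ₀}` on `Re w = σ₀ = 1/2−η`,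
for `n ≥ N` use `‖T(ν, ·)‖ ≪ ν^{−σ₁} u^{4−σ₁}` on `Re w = σ₁ = 5/4−η` at the four nodes; the partial sums of the
majorant are `≤ δ̂₁ m⁻⁴ N` (`LandauSums`), and the powers of `m` cancel.
[cite: LowrydudaTaniguchiThorne2017, §2.2 (eq:W_split)–(eq:Wp_final) (the choice z ≍ m⁴x³/y⁴ and the two ranges)] -/
theorem exists_norm_fwdDiff_three_dualSeries_le (hU : btt_uniformity_sqDvd) {η : ℝ} (hη0 : 0 < η) (hη1 : η ≤ 1 / 16) :
    ∃ C : ℝ, 0 < C ∧ ∀ (m : ℕ) [NeZero m] (Φ : BinaryCubic (ZMod m) → ℂ) (ε : ℤ), (ε = 1 ∨ ε = -1) →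
      ∀ u y : ℝ, 0 < y → 3 * y ≤ u →
        ‖((fwdDiff y)^[3] (dualSeries ε Φ)) u‖ ≤ C * dualDensity Φ * u ^ (2 + 4 * η) * y ^ (1 - 4 * η) := by
  set σ₀ : ℝ := 1 / 2 - η with hσ₀
  set σ₁ : ℝ := 5 / 4 - η with hσ₁
  have hσ₀a : 1 / 6 < σ₀ := by rw [hσ₀]; linarith
  have hσ₀b : σ₀ < 1 / 2 := by rw [hσ₀]; linarith
  have hσ₀c : 0 < σ₀ := by linarith
  have hσ₁a : 1 < σ₁ := by rw [hσ₁]; linarith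
  have hσ₁b : σ₁ < 5 / 4 := by rw [hσ₁]; linarith
  have h1σ₀ : 0 < 1 - σ₀ := by linarith
  have hσ₁1 : 0 < σ₁ - 1 := by linarith
  have h4σ₁ : 0 < 4 - σ₁ := by linarith
  obtain ⟨C₀, hC₀, hT₀⟩ := exists_norm_fwdDiff_three_kernelT_le (σ₁ := σ₀) (σ₂ := σ₀) hσ₀a hσ₀b
  obtain ⟨C₁, hC₁, hT₁⟩ := exists_norm_kernelT_le (σ₁ := σ₁) (σ₂ := σ₁) (by linarith) hσ₁b
  set K₀ : ℝ := 2 * C₀ * 2 ^ (1 - σ₀) * 2 ^ (1 - σ₀) * (2 + 1 / (1 - σ₀)) with hK₀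
  set K₁ : ℝ := 16 * C₁ * 2 ^ (4 - σ₁) * (2 + 1 / (σ₁ - 1)) with hK₁
  have hK₀0 : 0 ≤ K₀ := by positivity
  have hK₁0 : 0 ≤ K₁ := by positivity
  refine ⟨K₀ + K₁ + 1, by positivity, fun m _ Φ ε hε u y hy hyu => ?_⟩
  have hu : 0 < u := by linarith
  have hm : (0 : ℝ) < m := by exact_mod_cast NeZero.pos m
  have hm4 : (0 : ℝ) < (m : ℝ) ^ 4 := by positivity
  set D := dualDensity Φ with hDdef
  have hD : 0 ≤ D := dualDensity_nonneg Φ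
  have hx := dualMajorant_nonneg Φ
  have hA : ∀ k, ∑ n ∈ Finset.range k, dualMajorant Φ n ≤ D / (m : ℝ) ^ 4 * k := sum_range_dualMajorant_le hU Φ
  set P : ℝ := u ^ (2 + 4 * η) * y ^ (1 - 4 * η) with hP
  have hP0 : 0 ≤ P := by positivity
  set Z : ℝ := u ^ 3 / y ^ 4 with hZ
  have hZ0 : 0 < Z := by positivity
  set MZ : ℝ := (m : ℝ) ^ 4 * Z with hMZ
  have hMZ0 : 0 < MZ := by positivity
  set N : ℕ := ⌊MZ⌋₊ + 1 with hN
  have hN1 : 1 ≤ N := by omega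
  have hNgt : MZ < N := by rw [hN]; push_cast; exact Nat.lt_floor_add_one MZ
  have hNle : (N : ℝ) ≤ MZ + 1 := by rw [hN]; push_cast; linarith [Nat.floor_le hMZ0.le]
  have hN0 : (0 : ℝ) < N := by exact_mod_cast hN1
  -- abbreviations
  set ν : ℕ → ℝ := fun n => (n : ℝ) / (m : ℝ) ^ 4 with hν
  have hνpos : ∀ {n : ℕ}, 0 < n → 0 < ν n := fun hn => by simp only [hν]; positivity
  have hνpow : ∀ (n : ℕ) (c : ℝ), c ≠ 0 → ν n ^ (-c) = ((m : ℝ) ^ 4) ^ c * (n : ℝ) ^ (-c) := by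
    intro n c hc
    rcases Nat.eq_zero_or_pos n with rfl | hn
    · simp [hν, Real.zero_rpow (neg_ne_zero.mpr hc)]
    · simp only [hν]
      rw [Real.div_rpow (by positivity) hm4.le, Real.rpow_neg hm4.le, div_inv_eq_mul, mul_comm]
  set T : ℕ → ℝ → ℂ := fun n X' => kernelT ε (13 / 12) (ν n) X' with hT
  set g : ℕ → ℂ := fun n => dualThetaCoeff ε Φ n * ((fwdDiff y)^[3] (T n)) u with hg
  have hΔ : ((fwdDiff y)^[3] (dualSeries ε Φ)) u = ∑' n, g n := fwdDiff_three_dualSeries hU hε Φ hu hy.le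
  have hTσ : ∀ {n : ℕ}, 0 < n → ∀ σ : ℝ, σ ∈ Ioo (1 / 6 : ℝ) (5 / 4) → ∀ X' : ℝ, 0 < X' →
      T n X' = kernelT ε σ (ν n) X' :=
    fun hn σ hσ X' hX' => kernelT_eq_of_mem (hνpos hn) hX' hε (by constructor <;> norm_num) hσ
  have hg0 : g 0 = 0 := by
    simp only [hg, hT]
    rw [LandauDiff.fwdDiff_iter_three_apply]
    have : ν 0 = 0 := by simp [hν]
    simp [this, kernelT_zero_nu ε (by norm_num : (13 / 12 : ℝ) ≠ 0)]
  have hu3y : u + 3 * y ≤ 2 * u := by linarith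
  -- the bound for small `n` (line `Re w = σ₀`)
  have hsmall : ∀ n, ‖g n‖ ≤ 2 * C₀ * y ^ 3 * (2 * u) ^ (1 - σ₀) * ((m : ℝ) ^ 4) ^ σ₀ *
      (dualMajorant Φ n * (n : ℝ) ^ (-σ₀)) := by
    intro n
    rcases Nat.eq_zero_or_pos n with rfl | hn
    · rw [hg0, norm_zero]; exact mul_nonneg (by positivity) (mul_nonneg (hx 0) (by positivity))
    · have hmem : σ₀ ∈ Ioo (1 / 6 : ℝ) (5 / 4) := ⟨hσ₀a, by linarith⟩
      have hxn : 0 ≤ 2 * dualMajorant Φ n := by have := hx n; positivity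
      have hrew : ((fwdDiff y)^[3] (T n)) u = ((fwdDiff y)^[3] (fun X' => kernelT ε σ₀ (ν n) X')) u := by
        rw [LandauDiff.fwdDiff_iter_three_apply, LandauDiff.fwdDiff_iter_three_apply,
          hTσ hn σ₀ hmem (u + 3 * y) (by linarith), hTσ hn σ₀ hmem (u + 2 * y) (by linarith),
          hTσ hn σ₀ hmem (u + y) (by linarith), hTσ hn σ₀ hmem u hu]
      have hb := hT₀ ε hε σ₀ ⟨le_rfl, le_rfl⟩ (ν n) u y (hνpos hn) hu hy.le
      have hβ := norm_dualThetaCoeff_le Φ hε hn.ne'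
      simp only [hg, norm_mul]
      rw [hrew]
      calc ‖dualThetaCoeff ε Φ n‖ * ‖((fwdDiff y)^[3] (fun X' => kernelT ε σ₀ (ν n) X')) u‖
          ≤ (2 * dualMajorant Φ n) * (C₀ * (y ^ 3 * (ν n ^ (-σ₀) * (u + 3 * y) ^ (1 - σ₀)))) := by gcongr
        _ ≤ (2 * dualMajorant Φ n) * (C₀ * (y ^ 3 * (ν n ^ (-σ₀) * (2 * u) ^ (1 - σ₀)))) := by
            gcongr
        _ = 2 * C₀ * y ^ 3 * (2 * u) ^ (1 - σ₀) * ((m : ℝ) ^ 4) ^ σ₀ * (dualMajorant Φ n * (n : ℝ) ^ (-σ₀)) := by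
            rw [hνpow n σ₀ hσ₀c.ne']; ring
  -- the bound for large `n` (line `Re w = σ₁`, at the four nodes)
  have hlarge : ∀ n, ‖g n‖ ≤ 16 * C₁ * (2 * u) ^ (4 - σ₁) * ((m : ℝ) ^ 4) ^ σ₁ *
      (dualMajorant Φ n * (n : ℝ) ^ (-σ₁)) := by
    intro n
    rcases Nat.eq_zero_or_pos n with rfl | hn
    · rw [hg0, norm_zero]; exact mul_nonneg (by positivity) (mul_nonneg (hx 0) (by positivity))
    · have hmem : σ₁ ∈ Ioo (1 / 6 : ℝ) (5 / 4) := ⟨by linarith, hσ₁b⟩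
      have hxn : 0 ≤ 2 * dualMajorant Φ n := by have := hx n; positivity
      have hnode : ∀ X' : ℝ, u ≤ X' → X' ≤ 2 * u → ‖T n X'‖ ≤ C₁ * (ν n ^ (-σ₁) * (2 * u) ^ (4 - σ₁)) := by
        intro X' h1 h2
        have hX' : 0 < X' := by linarith
        rw [hTσ hn σ₁ hmem X' hX']
        calc ‖kernelT ε σ₁ (ν n) X'‖ ≤ C₁ * (ν n ^ (-σ₁) * X' ^ (4 - σ₁)) := hT₁ ε hε σ₁ ⟨le_rfl, le_rfl⟩ _ _ (hνpos hn) hX'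
          _ ≤ C₁ * (ν n ^ (-σ₁) * (2 * u) ^ (4 - σ₁)) := by
              gcongr
      have hb := norm_fwdDiff_three_le_of_le (f := T n) (y := y) (X := u) (hnode u le_rfl (by linarith))
        (hnode (u + y) (by linarith) (by linarith)) (hnode (u + 2 * y) (by linarith) (by linarith))
        (hnode (u + 3 * y) (by linarith) hu3y)
      have hβ := norm_dualThetaCoeff_le Φ hε hn.ne'
      simp only [hg, norm_mul]
      calc ‖dualThetaCoeff ε Φ n‖ * ‖((fwdDiff y)^[3] (T n)) u‖
          ≤ (2 * dualMajorant Φ n) * (8 * (C₁ * (ν n ^ (-σ₁) * (2 * u) ^ (4 - σ₁)))) := by gcongr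
        _ = 16 * C₁ * (2 * u) ^ (4 - σ₁) * ((m : ℝ) ^ 4) ^ σ₁ * (dualMajorant Φ n * (n : ℝ) ^ (-σ₁)) := by
            rw [hνpow n σ₁ (by linarith)]; ring
  -- summability and the split at `N`
  have hsum₁ := LandauSums.summable_mul_rpow_neg hx hA hσ₁a
  have hgsum : Summable fun n => ‖g n‖ :=
    Summable.of_nonneg_of_le (fun _ => norm_nonneg _) hlarge
      (hsum₁.mul_left (16 * C₁ * (2 * u) ^ (4 - σ₁) * ((m : ℝ) ^ 4) ^ σ₁))
  have hsplit : ∑' n, ‖g n‖ = ∑ n ∈ Finset.range N, ‖g n‖ + ∑' k, ‖g (k + N)‖ :=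
    (hgsum.sum_add_tsum_nat_add N).symm
  -- the tail
  have htail : ∑' k, ‖g (k + N)‖ ≤ K₁ * D * P := by
    have hs2 := LandauSums.summable_shift_mul_rpow_neg hx hA hσ₁a N
    have hle : ∀ k, ‖g (k + N)‖ ≤ 16 * C₁ * (2 * u) ^ (4 - σ₁) * ((m : ℝ) ^ 4) ^ σ₁ *
        (dualMajorant Φ (N + k) * ((N + k : ℕ) : ℝ) ^ (-σ₁)) := fun k => by
      have := hlarge (k + N); rwa [Nat.add_comm k N] at this ⊢
    have hgs : Summable fun k => ‖g (k + N)‖ := (summable_nat_add_iff (f := fun n => ‖g n‖) N).mpr hgsum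
    have htb := LandauSums.tsum_shift_mul_rpow_neg_le hx hA hσ₁a hN1
    have hNpow : (N : ℝ) ^ (1 - σ₁) ≤ MZ ^ (1 - σ₁) := Real.rpow_le_rpow_of_nonpos hMZ0 hNgt.le (by linarith)
    have hMZpow : ((m : ℝ) ^ 4) ^ σ₁ * (D / (m : ℝ) ^ 4) * MZ ^ (1 - σ₁) = D * Z ^ (1 - σ₁) := by
      rw [hMZ, Real.mul_rpow hm4.le hZ0.le]
      have e : ((m : ℝ) ^ 4) ^ σ₁ * ((m : ℝ) ^ 4) ^ (1 - σ₁) = (m : ℝ) ^ 4 := by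
        rw [← Real.rpow_add hm4]; simp
      calc ((m : ℝ) ^ 4) ^ σ₁ * (D / (m : ℝ) ^ 4) * (((m : ℝ) ^ 4) ^ (1 - σ₁) * Z ^ (1 - σ₁))
          = D * Z ^ (1 - σ₁) * ((((m : ℝ) ^ 4) ^ σ₁ * ((m : ℝ) ^ 4) ^ (1 - σ₁)) / (m : ℝ) ^ 4) := by ring
        _ = D * Z ^ (1 - σ₁) := by rw [e, div_self hm4.ne', mul_one]
    have hZpow : (2 * u) ^ (4 - σ₁) * Z ^ (1 - σ₁) = 2 ^ (4 - σ₁) * P := by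
      rw [Real.mul_rpow (by norm_num) hu.le, hZ, rpow_cube_div_fourth hu hy, hP]
      have e1 : u ^ (4 - σ₁) * u ^ (3 * (1 - σ₁)) = u ^ (2 + 4 * η) := by
        rw [← Real.rpow_add hu]; congr 1; rw [hσ₁]; ring
      have e2 : y ^ (-(4 * (1 - σ₁))) = y ^ (1 - 4 * η) := by congr 1; rw [hσ₁]; ring
      rw [← e1, ← e2]; ring
    calc ∑' k, ‖g (k + N)‖ ≤ ∑' k, 16 * C₁ * (2 * u) ^ (4 - σ₁) * ((m : ℝ) ^ 4) ^ σ₁ *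
          (dualMajorant Φ (N + k) * ((N + k : ℕ) : ℝ) ^ (-σ₁)) := Summable.tsum_le_tsum hle hgs (hs2.mul_left _)
      _ = 16 * C₁ * (2 * u) ^ (4 - σ₁) * ((m : ℝ) ^ 4) ^ σ₁ * ∑' k, dualMajorant Φ (N + k) * ((N + k : ℕ) : ℝ) ^ (-σ₁) :=
          tsum_mul_left
      _ ≤ 16 * C₁ * (2 * u) ^ (4 - σ₁) * ((m : ℝ) ^ 4) ^ σ₁ * (D / (m : ℝ) ^ 4 * (2 + 1 / (σ₁ - 1)) * MZ ^ (1 - σ₁)) := by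
          gcongr
          exact htb.trans (by gcongr)
      _ = 16 * C₁ * (2 + 1 / (σ₁ - 1)) * ((2 * u) ^ (4 - σ₁) * (((m : ℝ) ^ 4) ^ σ₁ * (D / (m : ℝ) ^ 4) * MZ ^ (1 - σ₁))) := by
          ring
      _ = K₁ * D * P := by rw [hMZpow, show (2 * u) ^ (4 - σ₁) * (D * Z ^ (1 - σ₁)) = D * ((2 * u) ^ (4 - σ₁) * Z ^ (1 - σ₁)) by ring, hZpow, hK₁]; ring
  -- the head
  have hhead : ∑ n ∈ Finset.range N, ‖g n‖ ≤ K₀ * D * P := by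
    by_cases hfl : ⌊MZ⌋₊ = 0
    · have hN1' : N = 1 := by rw [hN, hfl]
      rw [hN1', Finset.sum_range_one, hg0, norm_zero]; positivity
    · have hMZ1 : 1 ≤ MZ := by
        have : 0 < ⌊MZ⌋₊ := Nat.pos_of_ne_zero hfl
        exact (Nat.floor_pos.mp this)
      have hN2 : (N : ℝ) ≤ 2 * MZ := by linarith
      have hle : ∀ n ∈ Finset.range N, ‖g n‖ ≤ 2 * C₀ * y ^ 3 * (2 * u) ^ (1 - σ₀) * ((m : ℝ) ^ 4) ^ σ₀ *
          (dualMajorant Φ n * (n : ℝ) ^ (-σ₀)) := fun n _ => hsmall n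
      have hhb := LandauSums.sum_mul_rpow_neg_le hx hA hσ₀c (by linarith) hN1
      have h0term : dualMajorant Φ 0 * ((0 : ℕ) : ℝ) ^ (-σ₀) = 0 := by simp [dualMajorant]
      have hrange : ∑ n ∈ Finset.range N, dualMajorant Φ n * (n : ℝ) ^ (-σ₀) =
          ∑ n ∈ Finset.Ico 1 N, dualMajorant Φ n * (n : ℝ) ^ (-σ₀) := by
        rw [Finset.range_eq_Ico, Finset.sum_eq_sum_Ico_succ_bot hN1, h0term, zero_add]
      have hNpow : (N : ℝ) ^ (1 - σ₀) ≤ (2 * MZ) ^ (1 - σ₀) := Real.rpow_le_rpow hN0.le hN2 h1σ₀.le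
      have hMZpow : ((m : ℝ) ^ 4) ^ σ₀ * (D / (m : ℝ) ^ 4) * (2 * MZ) ^ (1 - σ₀) = 2 ^ (1 - σ₀) * D * Z ^ (1 - σ₀) := by
        rw [Real.mul_rpow (by norm_num) hMZ0.le, hMZ, Real.mul_rpow hm4.le hZ0.le]
        have e : ((m : ℝ) ^ 4) ^ σ₀ * ((m : ℝ) ^ 4) ^ (1 - σ₀) = (m : ℝ) ^ 4 := by
          rw [← Real.rpow_add hm4]; simp
        calc ((m : ℝ) ^ 4) ^ σ₀ * (D / (m : ℝ) ^ 4) * (2 ^ (1 - σ₀) * (((m : ℝ) ^ 4) ^ (1 - σ₀) * Z ^ (1 - σ₀)))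
            = 2 ^ (1 - σ₀) * D * Z ^ (1 - σ₀) * ((((m : ℝ) ^ 4) ^ σ₀ * ((m : ℝ) ^ 4) ^ (1 - σ₀)) / (m : ℝ) ^ 4) := by ring
          _ = 2 ^ (1 - σ₀) * D * Z ^ (1 - σ₀) := by rw [e, div_self hm4.ne', mul_one]
      have hZpow : y ^ 3 * (2 * u) ^ (1 - σ₀) * Z ^ (1 - σ₀) = 2 ^ (1 - σ₀) * P := by
        rw [Real.mul_rpow (by norm_num) hu.le, hZ, rpow_cube_div_fourth hu hy, hP, show (y ^ 3 : ℝ) = y ^ (3 : ℝ) by norm_cast]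
        have e1 : u ^ (1 - σ₀) * u ^ (3 * (1 - σ₀)) = u ^ (2 + 4 * η) := by
          rw [← Real.rpow_add hu]; congr 1; rw [hσ₀]; ring
        have e2 : y ^ (3 : ℝ) * y ^ (-(4 * (1 - σ₀))) = y ^ (1 - 4 * η) := by
          rw [← Real.rpow_add hy]; congr 1; rw [hσ₀]; ring
        rw [← e1, ← e2]; ring
      calc ∑ n ∈ Finset.range N, ‖g n‖ ≤ ∑ n ∈ Finset.range N, 2 * C₀ * y ^ 3 * (2 * u) ^ (1 - σ₀) * ((m : ℝ) ^ 4) ^ σ₀ *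
            (dualMajorant Φ n * (n : ℝ) ^ (-σ₀)) := Finset.sum_le_sum hle
        _ = 2 * C₀ * y ^ 3 * (2 * u) ^ (1 - σ₀) * ((m : ℝ) ^ 4) ^ σ₀ *
            ∑ n ∈ Finset.Ico 1 N, dualMajorant Φ n * (n : ℝ) ^ (-σ₀) := by rw [← Finset.mul_sum, hrange]
        _ ≤ 2 * C₀ * y ^ 3 * (2 * u) ^ (1 - σ₀) * ((m : ℝ) ^ 4) ^ σ₀ *
            (D / (m : ℝ) ^ 4 * (2 + 1 / (1 - σ₀)) * (2 * MZ) ^ (1 - σ₀)) := by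
            gcongr
            exact hhb.trans (by gcongr)
        _ = 2 * C₀ * (2 + 1 / (1 - σ₀)) * ((y ^ 3 * (2 * u) ^ (1 - σ₀)) *
            (((m : ℝ) ^ 4) ^ σ₀ * (D / (m : ℝ) ^ 4) * (2 * MZ) ^ (1 - σ₀))) := by ring
        _ = K₀ * D * P := by
            rw [hMZpow, show y ^ 3 * (2 * u) ^ (1 - σ₀) * (2 ^ (1 - σ₀) * D * Z ^ (1 - σ₀)) =
              2 ^ (1 - σ₀) * D * (y ^ 3 * (2 * u) ^ (1 - σ₀) * Z ^ (1 - σ₀)) by ring, hZpow, hK₀]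
            ring
  -- assemble
  have hDP : 0 ≤ D * P := mul_nonneg hD hP0
  have hfin : K₀ * D * P + K₁ * D * P ≤ (K₀ + K₁ + 1) * D * P := by
    have h1 : K₀ * D * P + K₁ * D * P = (K₀ + K₁) * (D * P) := by ring
    have h2 : (K₀ + K₁ + 1) * D * P = (K₀ + K₁ + 1) * (D * P) := by ring
    rw [h1, h2]
    exact mul_le_mul_of_nonneg_right (by linarith) hDP
  rw [hΔ, hP] at *
  calc ‖∑' n, g n‖ ≤ ∑' n, ‖g n‖ := norm_tsum_le_tsum_norm hgsum
    _ = ∑ n ∈ Finset.range N, ‖g n‖ + ∑' k, ‖g (k + N)‖ := hsplit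
    _ ≤ K₀ * D * (u ^ (2 + 4 * η) * y ^ (1 - 4 * η)) + K₁ * D * (u ^ (2 + 4 * η) * y ^ (1 - 4 * η)) :=
        add_le_add hhead htail
    _ ≤ (K₀ + K₁ + 1) * D * (u ^ (2 + 4 * η) * y ^ (1 - 4 * η)) := hfin
    _ = (K₀ + K₁ + 1) * D * u ^ (2 + 4 * η) * y ^ (1 - 4 * η) := by ring

end LandauShintani

end Literature.NumberTheory.CubicFields

end
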